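import Literature.NumberTheory.LFunctions.ZetaArgVariation
import Literature.NumberTheory.LFunctions.PrimeLogSeries
import HarnessLib

/-!
# `S(T)` through the prime logarithm: `π S(T) = Im log ζ(σ+iT) − Im ∫_{1/2}^{σ} ζ'/ζ (x+iT) dx`

Topic `Literature/NumberTheory/LFunctions`.  Everything in this file is PROVED; there are no named
facts and no definitions.

Backlund's formula in the tree (`Literature.NumberTheory.LFunctions.pi_mul_zetaArgS_eq`,
`ZetaArgVariation.lean`) evaluates `π S(T)` along `2 → 2 + iT → ½ + iT`.  Explicit bounds for
`S(T)` (Backlund 1918, Trudgian 2014, Hasanalizade–Shen–Wong 2022) start the horizontal segment at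
a parameter `σ₁ ∈ (1, 2]` and bound the rest by `|arg ζ(σ₁ + iT)| ≤ log ζ(σ₁)`, where `arg` is the
continuous argument from `+∞`, i.e. the imaginary part of the Euler-product logarithm
`log ζ(s) = Σ_p −log(1 − p^{-s})` — in the tree `Literature.NumberTheory.LFunctions.Nicolas.primeZetaLog`
(`PrimeLogSeries.lean`: holomorphic on `Re s > 1`, `exp ∘ log ζ = ζ`, real on `(1,∞)`).  We prove:

* `ZetaArgPrimeZetaLog.norm_log_one_sub_le_neg_log` — `‖log(1−z)‖ ≤ −log(1−‖z‖)` (`‖z‖ < 1`);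
  `ZetaArgPrimeZetaLog.norm_primeZetaLog_le` — **`|log ζ(σ+it)| ≤ log ζ(σ)`** (`σ > 1`);
* `ZetaArgPrimeZetaLog.deriv_primeZetaLog` — `(log ζ)' = ζ'/ζ` on `Re s > 1`;
  `ZetaArgPrimeZetaLog.primeZetaLog_eq_log` — on `Re s ≥ 2` it is the principal logarithm;
* `ZetaArgPrimeZetaLog.integral_logDeriv_riemannZeta_horizontal_eq`,
  `ZetaArgPrimeZetaLog.I_mul_integral_logDeriv_riemannZeta_vertical_eq` — FTC along segments in
  `Re s > 1`;
* `ZetaArgPrimeZetaLog.pi_mul_zetaArgS_eq_im_primeZetaLog_sub` — **for `T > 0` not an ordinate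
  and `1 < σ ≤ 2`: `π S(T) = Im log ζ(σ+iT) − Im ∫_{1/2}^{σ} ζ'/ζ(x+iT) dx`**;
  `ZetaArgPrimeZetaLog.pi_mul_abs_zetaArgS_le` — hence
  `π |S(T)| ≤ log ζ(σ) + |Im ∫_{1/2}^{σ} ζ'/ζ(x+iT) dx|` ([HSW22, (2.9)–(2.10) with `σ₁`]).

## References

* E. C. Titchmarsh, *The Theory of the Riemann Zeta-Function*, 2nd ed. (1986), §9.3 (Thm. 9.3),
  §9.4. [cite: Titchmarsh1986, Thm. 9.3]
* E. Hasanalizade, Q. Shen, P.-J. Wong, *Counting zeros of the Riemann zeta function*, J. Number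
  Theory 235 (2022), 219–241, §2, (2.9)–(2.10). [cite: HasanalizadeShenWong2022, §2]
-/

noncomputable section

open Complex Set MeasureTheory Filter Topology intervalIntegral Real
open scoped Real ComplexConjugate

namespace Literature.NumberTheory.LFunctions

namespace ZetaArgPrimeZetaLog

open Nicolas

/-- `‖log(1 - z)‖ ≤ -log(1 - ‖z‖)` for `‖z‖ < 1` (compare the Taylor series termwise).
[folklore] -/
theorem norm_log_one_sub_le_neg_log {z : ℂ} (hz : ‖z‖ < 1) :
    ‖-Complex.log (1 - z)‖ ≤ -Real.log (1 - ‖z‖) := by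
  have h1 := Complex.hasSum_taylorSeries_neg_log hz
  have hx : ‖((‖z‖ : ℝ) : ℂ)‖ < 1 := by simpa using hz
  have h2 := (Complex.hasSum_taylorSeries_neg_log hx).mapL Complex.reCLM
  have h2' : HasSum (fun n : ℕ ↦ ‖z‖ ^ n / n) (-Real.log (1 - ‖z‖)) := by
    have e1 : ∀ n : ℕ, Complex.reCLM ((((‖z‖ : ℝ) : ℂ)) ^ n / n) = ‖z‖ ^ n / n := by
      intro n
      rw [Complex.reCLM_apply, ← Complex.ofReal_pow, ← Complex.ofReal_natCast,
        ← Complex.ofReal_div, Complex.ofReal_re]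
    have e2 : Complex.reCLM (-Complex.log (1 - ((‖z‖ : ℝ) : ℂ))) = -Real.log (1 - ‖z‖) := by
      rw [Complex.reCLM_apply, Complex.neg_re, ← Complex.ofReal_one, ← Complex.ofReal_sub,
        Complex.log_ofReal_re]
    simpa [Function.comp_def, e1, e2] using h2
  refine h1.norm_le_of_bounded h2' fun n ↦ ?_
  rw [norm_div, norm_pow, Complex.norm_natCast]

/-- **`|log ζ(σ + it)| ≤ log ζ(σ)`** for the prime logarithm `log ζ = Σ_p -log(1 - p^{-s})`
(`Nicolas.primeZetaLog`) and `σ > 1`. [cite: Titchmarsh1986, §9.3] -/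
theorem norm_primeZetaLog_le {w : ℂ} (hw : 1 < w.re) :
    ‖primeZetaLog w‖ ≤ Real.log (riemannZeta (w.re : ℂ)).re := by
  -- the real series at `σ = Re w`
  set g : Nat.Primes → ℝ := fun p ↦ -Real.log (1 - ((p : ℕ) : ℝ) ^ (-w.re)) with hg
  have hσ : 1 < ((w.re : ℂ)).re := by simpa using hw
  have hgsum : Summable g := by
    have h := (summable_primeZetaLog hσ).norm
    refine h.congr fun p ↦ ?_
    have hp : (0 : ℝ) < 1 - ((p : ℕ) : ℝ) ^ (-w.re) := by
      have h1 : ((p : ℕ) : ℝ) ^ (-w.re) < 1 :=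
        Real.rpow_lt_one_of_one_lt_of_neg (by exact_mod_cast p.2.one_lt) (by linarith)
      linarith
    rw [primes_cpow_neg_ofReal, norm_neg, ← Complex.ofReal_one, ← Complex.ofReal_sub,
      ← Complex.ofReal_log hp.le, Complex.norm_real, Real.norm_eq_abs, hg]
    simp only
    rw [abs_of_nonpos (Real.log_nonpos hp.le
      (by linarith [Real.rpow_nonneg (Nat.cast_nonneg (p : ℕ)) (-w.re)]))]
  have hga : (∑' p, g p) = Real.log (riemannZeta (w.re : ℂ)).re := by
    have h1 : primeZetaLog (w.re : ℂ) = ((∑' p, g p : ℝ) : ℂ) := primeZetaLog_ofReal hw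
    have h2 := exp_primeZetaLog hσ
    rw [h1, ← Complex.ofReal_exp] at h2
    have h3 : (riemannZeta (w.re : ℂ)).re = Real.exp (∑' p, g p) := by
      rw [← h2, Complex.ofReal_re]
    rw [h3, Real.log_exp]
  rw [← hga, primeZetaLog]
  refine tsum_of_norm_bounded hgsum.hasSum fun p ↦ ?_
  have hlt := norm_primes_cpow_neg_lt_one p (by linarith : 0 < w.re)
  refine (norm_log_one_sub_le_neg_log hlt).trans ?_
  rw [norm_primes_cpow_neg]

/-- `primeZetaLog` is analytic at every point of `Re w > 1`. [folklore] -/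
theorem analyticAt_primeZetaLog {w : ℂ} (hw : 1 < w.re) : AnalyticAt ℂ primeZetaLog w :=
  differentiableOn_primeZetaLog.analyticAt ((isOpen_lt continuous_const continuous_re).mem_nhds hw)

/-- **`(log ζ)' = ζ'/ζ`** for the prime logarithm on `Re w > 1`. [folklore] -/
theorem deriv_primeZetaLog {w : ℂ} (hw : 1 < w.re) :
    deriv primeZetaLog w = deriv riemannZeta w / riemannZeta w := by
  have hζ : riemannZeta w ≠ 0 := riemannZeta_ne_zero_of_one_lt_re hw
  have hev : (fun z ↦ Complex.exp (primeZetaLog z)) =ᶠ[𝓝 w] riemannZeta := by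
    filter_upwards [(isOpen_lt continuous_const continuous_re).mem_nhds hw] with z hz
    exact exp_primeZetaLog hz
  have hd : HasDerivAt (fun z ↦ Complex.exp (primeZetaLog z))
      (Complex.exp (primeZetaLog w) * deriv primeZetaLog w) w :=
    (analyticAt_primeZetaLog hw).differentiableAt.hasDerivAt.cexp
  have h1 : deriv riemannZeta w = Complex.exp (primeZetaLog w) * deriv primeZetaLog w := by
    rw [← hev.deriv_eq]; exact hd.deriv
  rw [h1, exp_primeZetaLog hw, mul_div_cancel_left₀ _ hζ]

/-- On `Re w ≥ 2` the prime logarithm is the principal logarithm of `ζ(w)` (both have modulus of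
the imaginary part `< π`: `|Im log ζ| ≤ log ζ(2) < 1`). [folklore] -/
theorem primeZetaLog_eq_log {w : ℂ} (hw : 2 ≤ w.re) :
    primeZetaLog w = Complex.log (riemannZeta w) := by
  have hw1 : 1 < w.re := by linarith
  have hb := norm_primeZetaLog_le hw1
  have hζ2 : Real.log (riemannZeta (w.re : ℂ)).re ≤ 1 := by
    have hπ := Real.pi_lt_d2
    have hpos : 0 < (riemannZeta (w.re : ℂ)).re :=
      riemannZeta_re_pos_of_two_le (w := (w.re : ℂ)) (by simpa using hw)
    have hle : (riemannZeta (w.re : ℂ)).re ≤ π ^ 2 / 6 := by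
      have h1 := norm_riemannZeta_sub_one_le (w := (w.re : ℂ)) (by simpa using hw)
      have h2 : (riemannZeta (w.re : ℂ)).re - 1 ≤ ‖riemannZeta (w.re : ℂ) - 1‖ := by
        have := re_le_norm (riemannZeta (w.re : ℂ) - 1)
        simpa using this
      linarith
    calc Real.log (riemannZeta (w.re : ℂ)).re ≤ Real.log (π ^ 2 / 6) := Real.log_le_log hpos hle
      _ ≤ 1 := by
          rw [Real.log_le_iff_le_exp (by positivity)]
          have := Real.add_one_le_exp (1 : ℝ)
          nlinarith [Real.pi_pos]
  have him : |(primeZetaLog w).im| < π := by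
    have := abs_im_le_norm (primeZetaLog w)
    linarith [Real.pi_gt_three]
  rw [abs_lt] at him
  rw [← exp_primeZetaLog hw1, Complex.log_exp him.1 him.2.le]


/-- FTC for the prime logarithm along a horizontal segment in `Re s > 1`:
`∫_a^b ζ'/ζ(x+it) dx = log ζ(b+it) − log ζ(a+it)`. [folklore] -/
theorem integral_logDeriv_riemannZeta_horizontal_eq {a b t : ℝ} (ha : 1 < a) (hab : a ≤ b) :
    ∫ x in a..b, deriv riemannZeta ((x : ℂ) + t * I) / riemannZeta ((x : ℂ) + t * I) =
      primeZetaLog ((b : ℂ) + t * I) - primeZetaLog ((a : ℂ) + t * I) := by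
  have hre : ∀ x ∈ uIcc a b, 1 < (((x : ℂ) + t * I)).re := by
    intro x hx; rw [uIcc_of_le hab] at hx; simp; linarith [hx.1]
  have hderiv : ∀ x ∈ uIcc a b, HasDerivAt (fun x : ℝ ↦ primeZetaLog ((x : ℂ) + t * I))
      (deriv riemannZeta ((x : ℂ) + t * I) / riemannZeta ((x : ℂ) + t * I)) x := by
    intro x hx
    have h1 : HasDerivAt (fun w : ℂ ↦ w + t * I) 1 (x : ℂ) := (hasDerivAt_id (x : ℂ)).add_const _
    have h2 := (analyticAt_primeZetaLog (hre x hx)).differentiableAt.hasDerivAt.comp (x : ℂ) h1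
    rw [mul_one, deriv_primeZetaLog (hre x hx)] at h2
    exact h2.comp_ofReal
  have hcont : ContinuousOn (fun x : ℝ ↦ deriv riemannZeta ((x : ℂ) + t * I) /
      riemannZeta ((x : ℂ) + t * I)) (uIcc a b) := by
    intro x hx
    have h1 : ((x : ℂ) + t * I) ≠ 1 := fun h ↦ by
      have := congrArg Complex.re h; simp at this; rw [uIcc_of_le hab] at hx; linarith [hx.1]
    have hζ := riemannZeta_ne_zero_of_one_lt_re (hre x hx)
    have hline : Continuous fun x : ℝ ↦ (x : ℂ) + t * I := by fun_prop
    exact ((continuousAt_logDeriv_riemannZeta h1 hζ).comp (f := fun x : ℝ ↦ (x : ℂ) + t * I)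
      hline.continuousAt).continuousWithinAt
  exact intervalIntegral.integral_eq_sub_of_hasDerivAt hderiv (hcont.intervalIntegrable)

/-- FTC for the prime logarithm along the vertical segment `2 → 2 + iT`:
`i ∫₀ᵀ ζ'/ζ(2+iy) dy = log ζ(2+iT) − log ζ(2)`. [folklore] -/
theorem I_mul_integral_logDeriv_riemannZeta_vertical_eq (T : ℝ) :
    I * ∫ y in (0 : ℝ)..T, deriv riemannZeta (2 + y * I) / riemannZeta (2 + y * I) =
      primeZetaLog (2 + T * I) - primeZetaLog 2 := by
  have hre : ∀ y : ℝ, 1 < ((2 : ℂ) + y * I).re := fun y ↦ by simp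
  have hderiv : ∀ y ∈ uIcc 0 T, HasDerivAt (fun y : ℝ ↦ primeZetaLog (2 + y * I))
      (deriv riemannZeta (2 + y * I) / riemannZeta (2 + y * I) * I) y := by
    intro y _
    have h1 : HasDerivAt (fun w : ℂ ↦ 2 + w * I) I (y : ℂ) := by
      simpa using ((hasDerivAt_id (y : ℂ)).mul_const I).const_add 2
    have h2 := (analyticAt_primeZetaLog (hre y)).differentiableAt.hasDerivAt.comp (y : ℂ) h1
    rw [deriv_primeZetaLog (hre y)] at h2
    exact h2.comp_ofReal
  have hcont : Continuous (fun y : ℝ ↦ deriv riemannZeta (2 + y * I) / riemannZeta (2 + y * I) * I) := by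
    have hline : Continuous fun y : ℝ ↦ (2 : ℂ) + y * I := by fun_prop
    refine Continuous.mul ?_ continuous_const
    rw [continuous_iff_continuousAt]
    intro y
    have h1 : ((2 : ℂ) + y * I) ≠ 1 := fun h ↦ by have := congrArg Complex.re h; simp at this
    exact (continuousAt_logDeriv_riemannZeta h1 (riemannZeta_ne_zero_of_one_lt_re (hre y))).comp
      (f := fun y : ℝ ↦ (2 : ℂ) + y * I) hline.continuousAt
  have h := intervalIntegral.integral_eq_sub_of_hasDerivAt hderiv (hcont.intervalIntegrable _ _)
  simp only [Complex.ofReal_zero, zero_mul, add_zero] at h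
  rw [← h, intervalIntegral.integral_mul_const, mul_comm]

/-- **Backlund's formula with the prime logarithm.** For `T > 0` not the ordinate of a zero and
`1 < σ ≤ 2`:  `π S(T) = Im log ζ(σ + iT) − Im ∫_{1/2}^{σ} ζ'/ζ(x + iT) dx`, where `log ζ` is the
prime logarithm `Σ_p −log(1 − p^{-s})` (the branch that is real on `(1, ∞)` and continuous on
`Re s > 1`, so that `Im log ζ(σ+iT)` *is* the variation of `arg ζ` along `+∞ → σ + iT`).
[cite: Titchmarsh1986, Thm. 9.3] -/
theorem pi_mul_zetaArgS_eq_im_primeZetaLog_sub {T σ : ℝ} (hT : 0 < T)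
    (hT' : ∀ ρ : ℂ, riemannZeta ρ = 0 → ρ.im ≠ T) (hσ : 1 < σ) (hσ2 : σ ≤ 2) :
    π * zetaArgS T = (primeZetaLog ((σ : ℂ) + T * I)).im -
      (∫ x in (1 / 2 : ℝ)..σ, deriv riemannZeta ((x : ℂ) + T * I) / riemannZeta ((x : ℂ) + T * I)).im := by
  have h := pi_mul_zetaArgS_eq hT hT'
  have hvert := I_mul_integral_logDeriv_riemannZeta_vertical_eq T
  have h2real : (primeZetaLog 2).im = 0 := by
    have := primeZetaLog_ofReal_im (x := 2) (by norm_num)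
    simpa using this
  -- split the horizontal integral at `σ`
  have hζT : ∀ x : ℝ, riemannZeta ((x : ℂ) + T * I) ≠ 0 := fun x hx ↦ hT' _ hx (by simp)
  have hcont : ContinuousOn (fun x : ℝ ↦ deriv riemannZeta ((x : ℂ) + T * I) /
      riemannZeta ((x : ℂ) + T * I)) univ := by
    intro x _
    have h1 : ((x : ℂ) + T * I) ≠ 1 := fun h ↦ by
      have := congrArg Complex.im h; simp at this; exact hT.ne' this
    have hline : Continuous fun x : ℝ ↦ (x : ℂ) + T * I := by fun_prop
    exact ((continuousAt_logDeriv_riemannZeta h1 (hζT x)).comp (f := fun x : ℝ ↦ (x : ℂ) + T * I)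
      hline.continuousAt).continuousWithinAt
  have hint : ∀ a b : ℝ, IntervalIntegrable (fun x : ℝ ↦ deriv riemannZeta ((x : ℂ) + T * I) /
      riemannZeta ((x : ℂ) + T * I)) volume a b := fun a b ↦
    (hcont.mono (subset_univ _)).intervalIntegrable
  have hsplit := (intervalIntegral.integral_add_adjacent_intervals (hint (1 / 2) σ) (hint σ 2)).symm
  have hhor := integral_logDeriv_riemannZeta_horizontal_eq (t := T) hσ hσ2
  rw [h, hvert, hsplit, hhor, Complex.sub_im, Complex.add_im, Complex.sub_im, h2real]
  push_cast
  ring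

/-- **`π |S(T)| ≤ log ζ(σ) + |Im ∫_{1/2}^{σ} ζ'/ζ(x + iT) dx|`** for `T > 0` not an ordinate and
`1 < σ ≤ 2` (`|Im log ζ(σ+iT)| ≤ |log ζ(σ+iT)| ≤ log ζ(σ)`). [cite: Titchmarsh1986, §9.4] -/
theorem pi_mul_abs_zetaArgS_le {T σ : ℝ} (hT : 0 < T)
    (hT' : ∀ ρ : ℂ, riemannZeta ρ = 0 → ρ.im ≠ T) (hσ : 1 < σ) (hσ2 : σ ≤ 2) :
    π * |zetaArgS T| ≤ Real.log (riemannZeta (σ : ℂ)).re +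
      |(∫ x in (1 / 2 : ℝ)..σ, deriv riemannZeta ((x : ℂ) + T * I) / riemannZeta ((x : ℂ) + T * I)).im| := by
  have h := pi_mul_zetaArgS_eq_im_primeZetaLog_sub hT hT' hσ hσ2
  have hG := norm_primeZetaLog_le (w := (σ : ℂ) + T * I) (by simpa using hσ)
  simp only [add_re, ofReal_re, mul_re, I_re, mul_zero, ofReal_im, I_im, mul_one, sub_self,
    add_zero] at hG
  have him := (abs_im_le_norm (primeZetaLog ((σ : ℂ) + T * I))).trans hG
  rw [← abs_of_pos Real.pi_pos, ← abs_mul, h]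
  exact (abs_sub _ _).trans (add_le_add him le_rfl)

end ZetaArgPrimeZetaLog

end Literature.NumberTheory.LFunctions
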